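import Summits.BirchSwinnertonDyer.Rank1Residual.X2.ConnectingHomomorphism
import Summits.BirchSwinnertonDyer.Rank1Residual.X2.ResidualDevissageModules
import Literature.NumberTheory.EllipticCurves.IsogenyDualProofs
import Literature.NumberTheory.EllipticCurves.SelmerCorankProofs
import Literature.NumberTheory.EllipticCurves.BSDSha
import Literature.NumberTheory.EllipticCurves.H1UnramifiedFinite
import HarnessLib

/-!
# The Selmer group of a `K`-isogeny `φ : E → E'` and the lower bound it gives for `#Ш(E/K)`
# (cell `b2b-bsdres`, unit `b2b-bsdres-eisenstein-p2`, gen 24; the curve layer over gen 24's generic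
# `X2/ConnectingHomomorphism.lean`)

HONEST FRAMING (run/shared/lean/b2b/bsd-rank1-residual/, verbatim in every file): the goal of the
cell is to DELETE the COMBINATION-SHAPED residual classes of the Birch–Swinnerton-Dyer formula for
ALL analytic-rank `≤ 1` elliptic curves over `ℚ` — "full BSD formula for every rank `≤ 1` curve in
class `C`" assembled STRICTLY from published theorems — so that the rank-`≤ 1` remainder becomes
exactly the CONSTRUCTION-SHAPED classes, which are TYPED (missing-input `Prop`s), NOT attempted.
This is not "finishing BSD". Research route; NO CLAIM BEYOND STATED CLASSES; nothing here changes a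
label; nothing is booked. Definitions with bodies + theorems; no named fact.

WHY. On the X2b rank-`0` residue (N9 lane: 83 split cells at `p = 3`, `3 ∣ #Ш_an` on every curve of
every class, 75 with a rational `3`-torsion point) the per-curve lever is the Cassels certificate
`p ∣ #Ш(E/ℚ)` (`Typed/X2RankZeroCertificate`, `X1RankZeroCertificate`), which the lane's engines
produce by a `p`-ISOGENY descent (`Sel^{φ̂}(E'/ℚ) ⊂ ℚ^×/ℚ^{×3}` strictly bigger than the image of
`E(ℚ)`). The tree had the `[n]`-Selmer group (`WeierstrassCurve.selmerGroup`, X.4.2(a) for `[n]`: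
`pow_dvd_shaOrder_of_card_selmerGroup`) and the explicit `2`-isogeny sets, but no Selmer group of a
general isogeny. This file supplies it, with the half of Silverman X.4.2(a) that a LOWER bound for
`Ш` needs: `E'(K)/φ(E(K)) ≅ ker(H¹(K, E[φ]) → H¹(K, E)) ≤ Sel^{(φ)}(E/K)` and
`Sel^{(φ)}(E/K)/(that kernel) ↪ Ш(E/K)`, hence `#Sel^{(φ)} = #(E'(K̄)^{Γ_K}/φ(E(K̄)^{Γ_K})) · m` with
`m ∣ #Ш(E/K)`.

CONTENT (`K` a number field, `W`, `W'` elliptic, `φ : Isogeny W W'`):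
* §1 `kernelModule φ` (the `Γ_K`-stable subgroup `E[φ] = ker φ ≤ E(K̄)`, a `StableSubgroup`),
  `galH1Kernel φ = H¹(K, E[φ])`, `kernelToH1 φ : H¹(K, E[φ]) → H¹(K, E)`,
  `isogenySelmerLocalKer φ E` (kernel of `H¹(K, E[φ]) → H¹(E, E(K̄_E))` at a `K`-field `E`),
  **`isogenySelmerGroup φ = Sel^{(φ)}(E/K)`** (all finite and infinite places) — Silverman X.4.1.
* §2 `ker_kernelToH1_le_isogenySelmerGroup` (Kummer classes are Selmer),
  `map_kernelToH1_isogenySelmerGroup_le_sha` (Selmer classes map into `Ш(E/K)`),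
* §3 `natCard_isogenySelmerGroup_eq` : `#Sel^{(φ)} = #(E'(K̄)^{Γ}/φ(E(K̄)^{Γ})) · #(image)`,
  `exists_dvd_shaOrder_natCard_isogenySelmerGroup_eq`, and the certificate form
  **`pow_dvd_shaOrder_of_card_isogenySelmerGroup`**: `#Sel^{(φ)} = p^s`,
  `#(E'(K̄)^{Γ}/φ(E(K̄)^{Γ})) = p^t` ⇒ `p^{s−t} ∣ #Ш(E/K)`; and the torsion-only form
  **`pow_sub_padicValNat_dvd_shaOrder_of_card_isogenySelmerGroup`**: `#Sel^{(φ)} = p^s`,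
  `#E'(K̄)^{Γ} = N ≠ 0` ⇒ `p^{s − v_p(N)} ∣ #Ш(E/K)`.
The identification `E'(K̄)^{Γ_K} = E'(K)` is the tree's `fixedPoints_eq_range_map_holds`
(Galois descent), left to the consumer.

References: Silverman, *AEC*, VIII.§2, X.4.1–X.4.2; Serre, *Galois Cohomology*, I.§5.1;
Schaefer–Stoll, Trans. AMS 356 (2004) (isogeny descents as computed);
HOME/b2b-bsdres-eisenstein-p2/X2-LEDGER.md §3.
-/

noncomputable section
open scoped Classical
universe u

namespace Summit.BirchSwinnertonDyer.Rank1Residual.X2.IsogenySelmerGroup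

open WeierstrassCurve Literature.NumberTheory.EllipticCurves
  Literature.NumberTheory.GaloisRepresentations NumberField IsDedekindDomain
  Summit.BirchSwinnertonDyer.Rank1Residual.X2.ResidualDevissageModules
  Summit.BirchSwinnertonDyer.Rank1Residual.X2.TorsionComparison
  Summit.BirchSwinnertonDyer.Rank1Residual.X2.ConnectingHomomorphism

variable {K : Type u} [Field K] {W W' : WeierstrassCurve K}

/-! ## §1. `E[φ]`, `H¹(K, E[φ])`, the local kernels and `Sel^{(φ)}(E/K)` -/

/-- **`E[φ] = ker φ ≤ E(K̄)` as a `Γ_K`-stable subgroup** (`φ` is defined over `K`, so its kernel is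
Galois-stable: `φ(σ • P) = σ • φ P = 0`). Silverman, *AEC*, III.4 and X.4.1. [folklore] -/
def kernelModule (φ : Isogeny W W') : StableSubgroup (Field.absoluteGaloisGroup K) W.geomPoints where
  toAddSubgroup := φ.toAddMonoidHom.ker
  smul_mem' σ {P} hP := by
    rw [AddMonoidHom.mem_ker] at hP ⊢
    rw [Isogeny.coe_toAddMonoidHom, φ.map_smul, ← Isogeny.coe_toAddMonoidHom, hP, smul_zero]

/-- `H¹(K, E[φ]) = H¹_cont(Γ_K, E[φ])` (discrete coefficients). Silverman, *AEC*, X.4.1. [folklore] -/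
abbrev galH1Kernel (φ : Isogeny W W') : Type u :=
  discreteH1 (Field.absoluteGaloisGroup K) (kernelModule φ).Sub

/-- The map `H¹(K, E[φ]) → H¹(K, E)` induced by `E[φ] ↪ E(K̄)`. Silverman, *AEC*, X.4.1. [folklore] -/
def kernelToH1 (φ : Isogeny W W') : galH1Kernel φ →+ W.galH1 :=
  resH1Hom (ContinuousMonoidHom.id _) (kernelModule φ).incl (kernelModule φ).incl_smul_id

variable (E : Type u) [Field E] [Algebra K E]

/-- The local kernel at a `K`-field `E` (a completion `K_v`): the kernel of
`H¹(K, E[φ]) → H¹(E, E(K̄_E))` along the compatible pair `(resGal E, pointsMap ∘ (E[φ] ↪ E(K̄)))`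
— verbatim the tree's `selmerLocalKer` with `E[n]` replaced by `E[φ]`. Silverman, *AEC*, X.4.1.
[folklore] -/
def isogenySelmerLocalKer (φ : Isogeny W W') : AddSubgroup (galH1Kernel φ) :=
  resKer (resGal (K := K) E) ((pointsMap W E).comp (kernelModule φ).incl) fun σ P ↦ by
    simp only [AddMonoidHom.coe_comp, Function.comp_apply]
    rw [(kernelModule φ).incl_smul, pointsMap_smul]

variable {E}

section NumberField

variable [NumberField K]

/-- **The `φ`-Selmer group `Sel^{(φ)}(E/K) ≤ H¹(K, E[φ])`**: the classes whose image in
`H¹(K_v, E)` vanishes at every finite place `v` and every infinite place `w` (Silverman, *AEC*,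
X.4.1: "`S^{(φ)}(E/K) = ker{H¹(G_K, E[φ]) → ∏_v WC(E/K_v)}`"). [cite: SilvermanAEC2009, X.4.1] -/
def isogenySelmerGroup (φ : Isogeny W W') : AddSubgroup (galH1Kernel φ) :=
  (⨅ v : HeightOneSpectrum (𝓞 K), isogenySelmerLocalKer (v.adicCompletion K) φ) ⊓
    ⨅ w : InfinitePlace K, isogenySelmerLocalKer w.Completion φ

/-- Membership in `Sel^{(φ)}(E/K)`. [cite: SilvermanAEC2009, X.4.1] -/
theorem mem_isogenySelmerGroup_iff (φ : Isogeny W W') (c : galH1Kernel φ) :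
    c ∈ isogenySelmerGroup φ ↔
      (∀ v : HeightOneSpectrum (𝓞 K), c ∈ isogenySelmerLocalKer (v.adicCompletion K) φ) ∧
        ∀ w : InfinitePlace K, c ∈ isogenySelmerLocalKer w.Completion φ := by
  simp only [isogenySelmerGroup, AddSubgroup.mem_inf, AddSubgroup.mem_iInf]

end NumberField

/-! ## §2. Kummer classes are Selmer; Selmer classes map into `Ш` -/

/-- **A class dying in `H¹(K, E)` dies in every local `H¹(E, E(K̄_E))`**: if `(c σ) = σ • P − P` for
some `P ∈ E(K̄)`, then over `E` the class is the coboundary of `pointsMap P`. Hence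
`ker(H¹(K, E[φ]) → H¹(K, E)) ≤` every local kernel. Silverman, *AEC*, X.4.1–4.2 (the image of the
Kummer map lies in the Selmer group). [folklore] -/
theorem ker_kernelToH1_le_isogenySelmerLocalKer (φ : Isogeny W W') (E : Type u) [Field E]
    [Algebra K E] : (kernelToH1 φ).ker ≤ isogenySelmerLocalKer E φ := by
  intro c hc
  obtain ⟨f, rfl⟩ := classHom_surjective (G := Field.absoluteGaloisGroup K)
    (M := (kernelModule φ).Sub) c
  rw [AddMonoidHom.mem_ker, classHom_apply, kernelToH1, ResidualDevissage.pushH1_oneCocycleClass,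
    oneCocycleClass_eq_zero_iff] at hc
  obtain ⟨P, hP⟩ := hc
  have hP' : ∀ σ : Field.absoluteGaloisGroup K, (kernelModule φ).incl (f.1 σ) = σ • P - P := hP
  rw [classHom_apply, isogenySelmerLocalKer, oneCocycleClass_mem_resKer_iff]
  refine ⟨pointsMap W E P, fun x ↦ ?_⟩
  simp only [AddMonoidHom.coe_comp, Function.comp_apply]
  rw [hP', map_sub, pointsMap_smul]

/-- **`Sel^{(φ)}` maps into `Ш(E/K)`-type local kernels**: a class of `H¹(K, E[φ])` lying in the local
kernel at `E` maps, under `H¹(K, E[φ]) → H¹(K, E)`, into the local kernel `ker(H¹(K, E) → H¹(E, E))`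
(same cocycle criterion). Silverman, *AEC*, X.4.1. [folklore] -/
theorem kernelToH1_mem_localRestrictionKer (φ : Isogeny W W') (E : Type u) [Field E] [Algebra K E]
    {c : galH1Kernel φ} (hc : c ∈ isogenySelmerLocalKer E φ) :
    kernelToH1 φ c ∈ W.localRestrictionKer E := by
  obtain ⟨f, rfl⟩ := classHom_surjective (G := Field.absoluteGaloisGroup K)
    (M := (kernelModule φ).Sub) c
  rw [classHom_apply, isogenySelmerLocalKer, oneCocycleClass_mem_resKer_iff] at hc
  obtain ⟨a, ha⟩ := hc
  rw [classHom_apply, kernelToH1, ResidualDevissage.pushH1_oneCocycleClass, localRestrictionKer,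
    oneCocycleClass_mem_resKer_iff]
  exact ⟨a, fun x ↦ ha x⟩

section NumberField

variable [NumberField K]

/-- **Kummer classes are Selmer**: `ker(H¹(K, E[φ]) → H¹(K, E)) ≤ Sel^{(φ)}(E/K)`.
Silverman, *AEC*, X.4.2 (the Kummer sequence maps `E'(K)/φ(E(K))` into `S^{(φ)}`).
[cite: SilvermanAEC2009, X.4.1–4.2] -/
theorem ker_kernelToH1_le_isogenySelmerGroup (φ : Isogeny W W') :
    (kernelToH1 φ).ker ≤ isogenySelmerGroup φ := fun c hc ↦
  (mem_isogenySelmerGroup_iff φ c).2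
    ⟨fun v ↦ ker_kernelToH1_le_isogenySelmerLocalKer φ (v.adicCompletion K) hc,
      fun w ↦ ker_kernelToH1_le_isogenySelmerLocalKer φ w.Completion hc⟩

/-- **Selmer classes map into `Ш(E/K)`**: the image of `Sel^{(φ)}(E/K)` under
`H¹(K, E[φ]) → H¹(K, E)` lies in `Ш(E/K)` (Silverman, *AEC*, X.4.2(a): `S^{(φ)} → Ш(E/K)[φ]`).
[cite: SilvermanAEC2009, X.4.1–4.2] -/
theorem map_kernelToH1_isogenySelmerGroup_le_sha (φ : Isogeny W W') :
    (isogenySelmerGroup φ).map (kernelToH1 φ) ≤ W.sha := by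
  rintro _ ⟨c, hc, rfl⟩
  rw [SetLike.mem_coe, mem_isogenySelmerGroup_iff] at hc
  exact (W.mem_sha_iff _).2
    ⟨fun v ↦ kernelToH1_mem_localRestrictionKer φ _ (hc.1 v),
      fun w ↦ kernelToH1_mem_localRestrictionKer φ _ (hc.2 w)⟩

end NumberField

/-! ## §3. Counting: `#Sel^{(φ)} = #(E'(K̄)^Γ / φ(E(K̄)^Γ)) · m`, `m ∣ #Ш(E/K)` -/

omit [Field K] in
/-- For any subgroup `S` of an abelian group and any additive map `f`: `#S = #(S ⊓ ker f) · #f(S)`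
(first isomorphism theorem for `f|_S`; `Nat.card`, no finiteness needed). [folklore] -/
theorem natCard_eq_natCard_inf_ker_mul_natCard_map {A B : Type u} [AddCommGroup A]
    [AddCommGroup B] (f : A →+ B) (S : AddSubgroup A) :
    Nat.card S = Nat.card ↥(S ⊓ f.ker) * Nat.card (S.map f) := by
  set g : S →+ B := f.comp S.subtype with hg
  have hrange : g.range = S.map f := by
    rw [hg, AddMonoidHom.range_comp, AddSubgroup.range_subtype]
  have hker : Nat.card g.ker = Nat.card ↥(S ⊓ f.ker) := by
    refine Nat.card_congr ?_
    refine
      { toFun := fun x ↦ ⟨(x.1 : A), AddSubgroup.mem_inf.2 ⟨x.1.2, ?_⟩⟩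
        invFun := fun y ↦ ⟨⟨y.1, (AddSubgroup.mem_inf.1 y.2).1⟩, ?_⟩
        left_inv := fun x ↦ by ext; rfl
        right_inv := fun y ↦ by ext; rfl }
    · have hx := x.2
      rw [AddMonoidHom.mem_ker] at hx ⊢
      simpa [hg] using hx
    · have hy := (AddSubgroup.mem_inf.1 y.2).2
      rw [AddMonoidHom.mem_ker] at hy ⊢
      simpa [hg] using hy
  rw [← hrange, ← hker, ← Nat.card_congr (QuotientAddGroup.quotientKerEquivRange g).toEquiv,
    mul_comm, ← AddSubgroup.card_eq_card_quotient_mul_card_addSubgroup]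

/-- The hypotheses of the generic connecting homomorphism for the Kummer sequence
`0 → E[φ] → E(K̄) →φ E'(K̄) → 0` of an isogeny of ELLIPTIC curves: equivariance of `φ`. [folklore] -/
theorem isogeny_smul (φ : Isogeny W W') (σ : Field.absoluteGaloisGroup K) (P : W.geomPoints) :
    φ.toAddMonoidHom (σ • P) = σ • φ.toAddMonoidHom P := by
  rw [Isogeny.coe_toAddMonoidHom, φ.map_smul]

/-- Exactness of the Kummer sequence at `E(K̄)`: `φ P = 0 → P ∈ im(E[φ] ↪ E(K̄))`. [folklore] -/
theorem mem_range_incl_of_apply_eq_zero (φ : Isogeny W W') (P : W.geomPoints)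
    (hP : φ.toAddMonoidHom P = 0) : P ∈ (kernelModule φ).incl.range := by
  rw [(kernelModule φ).range_incl]
  exact (AddMonoidHom.mem_ker).2 hP

/-- `φ ∘ (E[φ] ↪ E(K̄)) = 0`. [folklore] -/
theorem apply_incl_eq_zero (φ : Isogeny W W') (x : (kernelModule φ).Sub) :
    φ.toAddMonoidHom ((kernelModule φ).incl x) = 0 := by
  have hx : (kernelModule φ).incl x ∈ (kernelModule φ).toAddSubgroup := by
    rw [← (kernelModule φ).range_incl]; exact ⟨x, rfl⟩
  exact (AddMonoidHom.mem_ker).1 hx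

variable [W.IsElliptic] [W'.IsElliptic]

/-- **`#ker(H¹(K, E[φ]) → H¹(K, E)) = #(E'(K̄)^{Γ_K} ⧸ φ(E(K̄)^{Γ_K}))`** — the Kummer isomorphism
`E'(K)/φ(E(K)) ≅ ker(H¹(K, E[φ]) → H¹(K, E))` of Silverman X.4.1–4.2, from the generic connecting
homomorphism (`ConnectingHomomorphism.kerEquiv`) applied to `0 → E[φ] → E(K̄) →φ E'(K̄) → 0`
(`φ` onto `E'(K̄)`: `Isogeny.surjective`; `E(K̄)` discrete: `continuous_smul_geomPoints`).
[cite: SilvermanAEC2009, X.4.1–4.2] -/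
theorem natCard_ker_kernelToH1_eq (φ : Isogeny W W') :
    Nat.card (kernelToH1 φ).ker =
      Nat.card (invariants (Field.absoluteGaloisGroup K) W'.geomPoints ⧸
        qInvariants (Field.absoluteGaloisGroup K) (q := φ.toAddMonoidHom) (isogeny_smul φ)) :=
  natCard_ker_pushH1_eq (hi := (kernelModule φ).incl_smul_id) (continuous_smul_geomPoints W)
    (isogeny_smul φ) (kernelModule φ).incl_injective φ.surjective
    (mem_range_incl_of_apply_eq_zero φ) (apply_incl_eq_zero φ)

variable [NumberField K]

/-- **`#Sel^{(φ)}(E/K) = #(E'(K̄)^{Γ}/φ(E(K̄)^{Γ})) · #(image of Sel^{(φ)} in H¹(K, E))`**, and the image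
lies in `Ш(E/K)`. (Silverman X.4.2(a) would add: the image is all of `Ш(E/K)[φ]`; not needed for a
lower bound and not proved here.) [cite: SilvermanAEC2009, X.4.1–4.2] -/
theorem natCard_isogenySelmerGroup_eq (φ : Isogeny W W') :
    Nat.card (isogenySelmerGroup φ) =
      Nat.card (invariants (Field.absoluteGaloisGroup K) W'.geomPoints ⧸
          qInvariants (Field.absoluteGaloisGroup K) (q := φ.toAddMonoidHom) (isogeny_smul φ)) *
        Nat.card ((isogenySelmerGroup φ).map (kernelToH1 φ)) := by
  rw [natCard_eq_natCard_inf_ker_mul_natCard_map (kernelToH1 φ) (isogenySelmerGroup φ),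
    inf_eq_right.2 (ker_kernelToH1_le_isogenySelmerGroup φ), natCard_ker_kernelToH1_eq]

/-- **`#Sel^{(φ)}(E/K) = #(E'(K̄)^{Γ}/φ(E(K̄)^{Γ})) · m` with `m ∣ #Ш(E/K)`** (`m` = the order of the
image of `Sel^{(φ)}` in `Ш(E/K)`; Lagrange in `Ш`, `#Ш := Nat.card`, no finiteness needed).
[cite: SilvermanAEC2009, X.4.1–4.2] -/
theorem exists_dvd_shaOrder_natCard_isogenySelmerGroup_eq (φ : Isogeny W W') :
    ∃ m : ℕ, m ∣ W.shaOrder ∧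
      Nat.card (isogenySelmerGroup φ) =
        Nat.card (invariants (Field.absoluteGaloisGroup K) W'.geomPoints ⧸
          qInvariants (Field.absoluteGaloisGroup K) (q := φ.toAddMonoidHom) (isogeny_smul φ)) * m :=
  ⟨Nat.card ((isogenySelmerGroup φ).map (kernelToH1 φ)),
    by rw [WeierstrassCurve.shaOrder]
       exact AddSubgroup.card_dvd_of_le (map_kernelToH1_isogenySelmerGroup_le_sha φ),
    natCard_isogenySelmerGroup_eq φ⟩

/-- **CERTIFICATE FORM — a `p`-isogeny descent bounds `#Ш(E/K)` from below.** If
`#Sel^{(φ)}(E/K) = p^s` and `#(E'(K̄)^{Γ_K}/φ(E(K̄)^{Γ_K})) = p^t` (by Galois descent this quotient is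
`E'(K)/φ(E(K))`; at rank `0` it is computed from the torsion subgroups), then `p^{s−t} ∣ #Ш(E/K)`.
This is the shape in which an isogeny-descent engine (the lane's `desc3iso`) reports
`dim Ш(E)[φ] ≥ s − t`; with Cassels–Tate squareness and Wuthrich's Prop. 21 it feeds
`Typed.bsdp_of_wuthrich_of_casselsTate_of_pow_dvd` / `Typed/X2RankZeroCertificate`.
[cite: SilvermanAEC2009, X.4.1–4.2] -/
theorem pow_dvd_shaOrder_of_card_isogenySelmerGroup (φ : Isogeny W W') {p s t : ℕ}
    (hp : p.Prime) (hS : Nat.card (isogenySelmerGroup φ) = p ^ s)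
    (hQ : Nat.card (invariants (Field.absoluteGaloisGroup K) W'.geomPoints ⧸
        qInvariants (Field.absoluteGaloisGroup K) (q := φ.toAddMonoidHom) (isogeny_smul φ)) = p ^ t) :
    p ^ (s - t) ∣ W.shaOrder := by
  obtain ⟨m, hm, hcard⟩ := exists_dvd_shaOrder_natCard_isogenySelmerGroup_eq φ
  rw [hS, hQ] at hcard
  -- `p^s = p^t · m`, so `m = p^(s-t)` (and `t ≤ s`)
  have hts : t ≤ s := by
    have h1 : p ^ t ∣ p ^ s := Dvd.intro m hcard.symm
    exact (Nat.pow_dvd_pow_iff_le_right hp.one_lt).1 h1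
  have hm' : m = p ^ (s - t) := by
    have hpt : 0 < p ^ t := Nat.pos_of_ne_zero (pow_ne_zero _ hp.ne_zero)
    have h2 : p ^ t * m = p ^ t * p ^ (s - t) := by
      rw [← hcard, ← pow_add, Nat.add_sub_cancel' hts]
    exact Nat.eq_of_mul_eq_mul_left hpt h2
  rw [← hm']
  exact hm

/-- **CERTIFICATE FORM WITH A TORSION BOUND ONLY.** If `#Sel^{(φ)}(E/K) = p^s` and the group of
`Γ_K`-fixed geometric points `E'(K̄)^{Γ_K}` (= `E'(K)` by Galois descent,
`fixedPoints_eq_range_map_holds`; finite of known order at rank `0`) has nonzero order `N`, then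
`p^{s − v_p(N)} ∣ #Ш(E/K)`: the quotient `E'(K̄)^{Γ}/φ(E(K̄)^{Γ})` has order dividing `N`, so in
`p^s = #quotient · m` the factor `m ∣ #Ш(E/K)` is a power of `p` at least `p^{s − v_p(N)}`. This is
the shape a rank-`0` engine feeds with `#Sel^{(φ)}` and `#E'(ℚ)_{tors}` alone.
[cite: SilvermanAEC2009, X.4.1–4.2] -/
theorem pow_sub_padicValNat_dvd_shaOrder_of_card_isogenySelmerGroup (φ : Isogeny W W') {p s : ℕ}
    [hp : Fact p.Prime] (hS : Nat.card (isogenySelmerGroup φ) = p ^ s)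
    (hN : Nat.card (invariants (Field.absoluteGaloisGroup K) W'.geomPoints) ≠ 0) :
    p ^ (s - padicValNat p (Nat.card (invariants (Field.absoluteGaloisGroup K) W'.geomPoints))) ∣
      W.shaOrder := by
  obtain ⟨m, hm, hcard⟩ := exists_dvd_shaOrder_natCard_isogenySelmerGroup_eq φ
  set Q := Nat.card (invariants (Field.absoluteGaloisGroup K) W'.geomPoints ⧸
    qInvariants (Field.absoluteGaloisGroup K) (q := φ.toAddMonoidHom) (isogeny_smul φ)) with hQdef
  -- `Q ∣ N`
  have hQN : Q ∣ Nat.card (invariants (Field.absoluteGaloisGroup K) W'.geomPoints) :=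
    Dvd.intro _ (AddSubgroup.card_eq_card_quotient_mul_card_addSubgroup _).symm
  rw [hS] at hcard
  -- `Q ∣ p^s`, so `Q = p^a` with `a ≤ s`, and `m = p^(s-a)`
  obtain ⟨a, ha, hQa⟩ := (Nat.dvd_prime_pow hp.out).1 (Dvd.intro m hcard.symm : Q ∣ p ^ s)
  have hm' : m = p ^ (s - a) := by
    have hpa : 0 < p ^ a := Nat.pos_of_ne_zero (pow_ne_zero _ hp.out.ne_zero)
    have h2 : p ^ a * m = p ^ a * p ^ (s - a) := by
      rw [← pow_add, Nat.add_sub_cancel' ha, hcard, hQa]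
    exact Nat.eq_of_mul_eq_mul_left hpa h2
  -- `a ≤ v_p(N)`
  have hav : a ≤ padicValNat p (Nat.card (invariants (Field.absoluteGaloisGroup K) W'.geomPoints)) :=
    (padicValNat_dvd_iff_le hN).1 (hQa ▸ hQN)
  calc p ^ (s - padicValNat p (Nat.card (invariants (Field.absoluteGaloisGroup K) W'.geomPoints)))
      ∣ p ^ (s - a) := pow_dvd_pow p (by omega)
    _ = m := hm'.symm
    _ ∣ W.shaOrder := hm

end Summit.BirchSwinnertonDyer.Rank1Residual.X2.IsogenySelmerGroup

end
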